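import Mathlib
import Summits.ValiantsHypothesis.ValiantsHypothesis.Theorems.KPlusLogSqLawTropicalBSingleGaugeExists
import Summits.ValiantsHypothesis.ValiantsHypothesis.Theorems.KPlusLogSqLawTropicalCensusRows

/-!
# Route «KPlusLogSqLaw», crux `TropicalB` (stmt-ValiantsHypothesis-19771) — COMPLETENESS OF THE DUAL CERTIFICATE:
# a term is dominant **iff** it carries a scaled integer potential certificate (strict complementary slackness, kernel form)

HONEST FRAMING.  Helper file (cell `pub-symmetroid`, seat val-sym-trop-p1 g22, 2026-08-28) `--supports` the crux
`Summit.ValiantsHypothesis.ValiantsHypothesis.Theses.KPlusLogSqLaw.TropicalB` (item `stmt-ValiantsHypothesis-19771`, route `KPlusLogSqLaw`,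
registered stubs `stub_tropThin` / `stub_tropFat` of `Cruxes/TropicalB/Lines/birth.lean`).  A STRUCTURE theorem about single dominant terms of
ARBITRARY designs (vocabulary `IsDominant` / `tropWeight` / `termSign`); it bounds nothing for `TropicalB` and bears on neither `TropicalB` in its
window, `WeakLifting`, DoorA26 / DoorA34, `MatrixDescartes` (stmt-ValiantsHypothesis-18050) nor VP ≠ VNP.

THE POINT.  The tree has the two HALVES of LP duality for dominance separately and in different shapes:
* SOUNDNESS `TropicalCensus.isDominant_of_scaledPotential` (p-census rows, val-sym-trop-p5 g9): integer potentials `u, w` that are TIGHT on the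
  term `(σ, μ)` at scale `S > 0` (`u (σ i) + w i = S·(θ·d(μ i) − v(σ i, i, μ i))`) and STRICTLY slack on every other present incidence certify
  `IsDominant` — the format of every census certificate of the cell (`(5,4) = 55`, `(6,4) ≥ 73`, …);
* EXISTENCE of a NON-strict row gauge `SingleGauge.exists_rowGauge_of_isDominant` (val-sym-trop-p5 g10): Egerváry potentials under which the
  term's incidence is *a* (not necessarily the unique) column-wise maximiser.
This file closes the loop: **every dominant term has a certificate in the strict, scaled format of `isDominant_of_scaledPotential`**, so that

  `isDominant_iff_scaledPotential : IsDominant d v ε θ (σ, μ) ↔ ∃ S > 0, ∃ u w, (present) ∧ (tight at scale S) ∧ (strictly slack elsewhere)`.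

Consequently dominance of ONE term — a universally quantified statement over all `m!·K^m` Leibniz terms — is EQUIVALENT to the solvability of a
system of `m + m²K` linear (in)equalities in `2m + 1` integer unknowns: the census currency `TropRootLawAt` is a statement about finitely many
linear systems, and every search / certificate pipeline of the cell that works with strict dual potentials (ktight, kverify, mkcert) loses nothing.

PROOF (strict complementary slackness by perturbation and averaging; integrality by doubling).  Fix the dominant term `q = (σ, μ)` at slope `θ`
and one incidence `c = (a, b, l)`.  In the PERTURBED design `(2d, 2v − 𝟙_c, ε)` every term's weight doubles and the terms through `c` gain `1`
(`tropWeight_perturb`); since the weights are integers and `q` wins by `≥ 1`, `q` is still dominant there provided `c` is not an incidence of `q`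
(`isDominant_perturb`).  Egerváry for that design (`exists_rowGauge_of_isDominant`) gives integer `u^c` and — defining the column potential `w^c b'`
as the gauged score of `q` in column `b'` — potentials tight on `q` at scale `2` and slack everywhere, with slack `≥ 1` AT `c`.  Summing these
certificates over all `m²K` incidences `c` (perturbing only at the competitors of `q`) gives integer potentials tight at scale `S = 2m²K` and
strictly slack at every competitor (`exists_scaledPotential_of_isDominant`).  [folklore: Goldman–Tucker strict complementarity for the assignment
LP, made integral; Egerváry 1931 via the tree]
-/

set_option linter.dupNamespace false
set_option autoImplicit false

namespace Summit.ValiantsHypothesis.ValiantsHypothesis.Theorems.KPlusLogSqLaw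

open Summit.ValiantsHypothesis.ValiantsHypothesis.Theorems.MatrixDescartes.Negative
open Summit.ValiantsHypothesis.ValiantsHypothesis.Theorems.LacunarySymmetroidMatrixDescartes
open Summit.ValiantsHypothesis.ValiantsHypothesis.Theorems.LacunarySymmetroidMatrixDescartes.TropicalCensus
open scoped BigOperators
open Finset

namespace PotentialCertificate

variable {m K : ℕ}

/-! ## 1. The one-incidence perturbation -/

/-- **Weights in the perturbed design** `(2d, 2v − 𝟙_{(a,b,l)})` (exponents doubled; valuations doubled and lowered by `1` at the single
incidence `(a, b, l)`, a bonus of `1/2` in original units): `tw' p = 2·tw p + [p passes through (a,b,l)]`. [folklore] -/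
theorem tropWeight_perturb (d : Fin K → ℕ) (v : Fin m → Fin m → Fin K → ℤ) (θ : ℤ) (a b : Fin m) (l : Fin K)
    (p : Equiv.Perm (Fin m) × (Fin m → Fin K)) :
    tropWeight (fun l' => 2 * d l') (fun i j l' => 2 * v i j l' - if i = a ∧ j = b ∧ l' = l then 1 else 0) θ p =
      2 * tropWeight d v θ p + (if p.1 b = a ∧ p.2 b = l then 1 else 0) := by
  rw [tropWeight_eq_sum, tropWeight_eq_sum]
  have hsplit : ∀ i, (θ * ((2 * d (p.2 i) : ℕ) : ℤ) - (2 * v (p.1 i) i (p.2 i) - if p.1 i = a ∧ i = b ∧ p.2 i = l then 1 else 0)) =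
      2 * (θ * (d (p.2 i) : ℤ) - v (p.1 i) i (p.2 i)) + (if p.1 i = a ∧ i = b ∧ p.2 i = l then 1 else 0) := by
    intro i
    simp only [Nat.cast_mul, Nat.cast_ofNat]
    ring
  simp_rw [hsplit]
  rw [Finset.sum_add_distrib, ← Finset.mul_sum]
  congr 1
  -- only column `b` can contribute to the indicator sum
  rw [Finset.sum_eq_single b]
  · by_cases h : p.1 b = a ∧ p.2 b = l
    · rw [if_pos h, if_pos ⟨h.1, rfl, h.2⟩]
    · rw [if_neg h, if_neg (fun h' => h ⟨h'.1, h'.2.2⟩)]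
  · intro i _ hib
    rw [if_neg (fun h' => hib h'.2.1)]
  · intro hb; exact absurd (mem_univ b) hb

/-- **The one-incidence perturbation keeps `q` dominant** as long as `q` does not pass through the perturbed incidence: all weights are
integers, `q` wins by at least `1`, and the perturbation is worth `1/2`. [folklore] -/
theorem isDominant_perturb (d : Fin K → ℕ) (v ε : Fin m → Fin m → Fin K → ℤ) (θ : ℤ) (a b : Fin m) (l : Fin K)
    (q : Equiv.Perm (Fin m) × (Fin m → Fin K)) (hq : IsDominant d v ε θ q) (hc : q.1 b ≠ a ∨ q.2 b ≠ l) :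
    IsDominant (fun l' => 2 * d l') (fun i j l' => 2 * v i j l' - if i = a ∧ j = b ∧ l' = l then 1 else 0) ε θ q := by
  refine ⟨hq.1, fun p' hne hp' => ?_⟩
  rw [tropWeight_perturb, tropWeight_perturb]
  have h0 : (if q.1 b = a ∧ q.2 b = l then (1 : ℤ) else 0) = 0 := by
    rw [if_neg]
    rintro ⟨h1, h2⟩
    rcases hc with hc | hc
    · exact hc h1
    · exact hc h2
  have h1 : (if p'.1 b = a ∧ p'.2 b = l then (1 : ℤ) else 0) ≤ 1 := by split_ifs <;> norm_num
  have h2 := hq.2 p' hne hp'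
  rw [h0]
  linarith

/-! ## 2. Completeness: every dominant term has a strict scaled certificate -/

/-- **COMPLETENESS OF THE DUAL CERTIFICATE.**  If `(σ, μ)` is the unique optimum of the design `(d, v, ε)` at the integer slope `θ`, then
there are a scale `S > 0` and INTEGER potentials `u, w : Fin m → ℤ` that are tight on the term at scale `S` and strictly slack on every other
present incidence — exactly the hypotheses of `TropicalCensus.isDominant_of_scaledPotential`.  [folklore: strict complementary slackness
(Goldman–Tucker) for the assignment LP; integral form via Egerváry (tree) + perturbation + averaging] -/
theorem exists_scaledPotential_of_isDominant (d : Fin K → ℕ) (v ε : Fin m → Fin m → Fin K → ℤ) (θ : ℤ)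
    (σ : Equiv.Perm (Fin m)) (μ : Fin m → Fin K) (hq : IsDominant d v ε θ (σ, μ)) :
    ∃ S : ℤ, 0 < S ∧ ∃ u w : Fin m → ℤ,
      (∀ i, ε (σ i) i (μ i) ≠ 0) ∧
      (∀ i, u (σ i) + w i = S * (θ * (d (μ i) : ℤ) - v (σ i) i (μ i))) ∧
      (∀ a b l, ε a b l ≠ 0 → (σ b ≠ a ∨ μ b ≠ l) → S * (θ * (d l : ℤ) - v a b l) < u a + w b) := by
  classical
  have hpres : ∀ i, ε (σ i) i (μ i) ≠ 0 := fun i => present_of_termSign_ne_zero ε (σ, μ) hq.1 i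
  -- the score of an incidence and the (competitor-only) perturbed valuations
  set sc : Fin m → Fin m → Fin K → ℤ := fun i j l => θ * (d l : ℤ) - v i j l with hsc
  let comp : Fin m × Fin m × Fin K → Prop := fun c => σ c.2.1 ≠ c.1 ∨ μ c.2.1 ≠ c.2.2
  let dbl : Fin K → ℕ := fun l' => 2 * d l'
  let V : Fin m × Fin m × Fin K → (Fin m → Fin m → Fin K → ℤ) := fun c =>
    if comp c then (fun i j l' => 2 * v i j l' - if i = c.1 ∧ j = c.2.1 ∧ l' = c.2.2 then 1 else 0) else fun i j l => 2 * v i j l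
  -- in every perturbed design the term stays dominant
  have hdomc : ∀ c, IsDominant dbl (V c) ε θ (σ, μ) := by
    intro c
    by_cases hcomp : comp c
    · simp only [V, if_pos hcomp, dbl]
      exact isDominant_perturb d v ε θ c.1 c.2.1 c.2.2 (σ, μ) hq hcomp
    · simp only [V, if_neg hcomp]
      -- unperturbed doubling: all weights double
      refine ⟨hq.1, fun p' hne hp' => ?_⟩
      have h2 := hq.2 p' hne hp'
      have e : ∀ p : Equiv.Perm (Fin m) × (Fin m → Fin K),
          tropWeight dbl (fun i j l => 2 * v i j l) θ p = 2 * tropWeight d v θ p := by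
        intro p
        rw [tropWeight_eq_sum, tropWeight_eq_sum, Finset.mul_sum]
        refine Finset.sum_congr rfl fun i _ => ?_
        simp only [dbl, Nat.cast_mul, Nat.cast_ofNat]
        ring
      rw [e, e]
      linarith
  -- Egerváry row gauges for each perturbed design
  have hg : ∀ c, ∃ u : Fin m → ℤ, ∀ (j i : Fin m) (l : Fin K), ε i j l ≠ 0 →
      (θ * ((dbl l : ℕ) : ℤ) - V c i j l) - u i ≤ (θ * ((dbl (μ j) : ℕ) : ℤ) - V c (σ j) j (μ j)) - u (σ j) :=
    fun c => SingleGauge.exists_rowGauge_of_isDominant dbl (V c) ε θ (σ, μ) (hdomc c)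
  choose uc huc using hg
  -- column potentials: the gauged score of the term
  let wc : (Fin m × Fin m × Fin K) → Fin m → ℤ := fun c j => (θ * ((dbl (μ j) : ℕ) : ℤ) - V c (σ j) j (μ j)) - uc c (σ j)
  -- the term's own incidences are never perturbed
  have hVq : ∀ c j, V c (σ j) j (μ j) = 2 * v (σ j) j (μ j) := by
    intro c j
    by_cases hcomp : comp c
    · simp only [V, if_pos hcomp]
      rw [if_neg]
      · ring
      · rintro ⟨h1, h2, h3⟩
        rcases hcomp with h | h
        · exact h (h2 ▸ h1.symm ▸ rfl)
        · exact h (h2 ▸ h3.symm ▸ rfl)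
    · simp only [V, if_neg hcomp]
  have hdbl : ∀ l, ((dbl l : ℕ) : ℤ) = 2 * (d l : ℤ) := fun l => by simp [dbl]
  -- tight at scale 2, per certificate
  have htightc : ∀ c j, uc c (σ j) + wc c j = 2 * sc (σ j) j (μ j) := by
    intro c j
    simp only [wc, hVq, hdbl, hsc]
    ring
  -- slack everywhere, with an extra unit AT the perturbed competitor
  have hslackc : ∀ c (a b : Fin m) (l : Fin K), ε a b l ≠ 0 →
      2 * sc a b l + (if comp c ∧ c = (a, b, l) then 1 else 0) ≤ uc c a + wc c b := by
    intro c a b l habl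
    have h := huc c b a l habl
    have hV : V c a b l = 2 * v a b l - (if comp c ∧ c = (a, b, l) then 1 else 0) := by
      by_cases hcomp : comp c
      · simp only [V, if_pos hcomp]
        by_cases he : c = (a, b, l)
        · rw [if_pos, if_pos ⟨hcomp, he⟩] 
          rcases c with ⟨c1, c2, c3⟩
          simp only [Prod.mk.injEq] at he
          exact ⟨he.1.symm, he.2.1.symm, he.2.2.symm⟩
        · rw [if_neg, if_neg (fun h' => he h'.2)]
          rintro ⟨h1, h2, h3⟩
          apply he
          rcases c with ⟨c1, c2, c3⟩
          simp only [Prod.mk.injEq]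
          exact ⟨h1.symm, h2.symm, h3.symm⟩
      · simp only [V, if_neg hcomp]
        rw [if_neg (fun h' => hcomp h'.1)]
        ring
    simp only [wc, hVq, hdbl, hV, hsc] at h ⊢
    linarith
  -- sum the certificates over all incidences
  let N : ℕ := Fintype.card (Fin m × Fin m × Fin K)
  refine ⟨2 * (N : ℤ) + (if N = 0 then 1 else 0), ?_, fun a => ∑ c, uc c a, fun b => ∑ c, wc c b, hpres, ?_, ?_⟩
  · by_cases hN : N = 0
    · rw [if_pos hN, hN]; norm_num
    · rw [if_neg hN]; positivity
  · intro i
    rw [← Finset.sum_add_distrib, Finset.sum_congr rfl fun c _ => htightc c i, Finset.sum_const, card_univ, nsmul_eq_mul]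
    by_cases hN : N = 0
    · -- no incidences at all: then `m = 0` or `K = 0`, and both sides vanish
      have : (Fintype.card (Fin m × Fin m × Fin K) : ℤ) = 0 := by exact_mod_cast hN
      rw [this, if_pos hN]
      exfalso
      have hK : Fintype.card (Fin m × Fin m × Fin K) = 0 := hN
      have hprod : m * (m * K) = 0 := by simpa [Fintype.card_prod, Fintype.card_fin] using hK
      rcases mul_eq_zero.mp hprod with hm | hmK
      · exact absurd i.isLt (by omega)
      · rcases mul_eq_zero.mp hmK with hm | hK0
        · exact absurd i.isLt (by omega)
        · exact absurd (μ i).isLt (by omega)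
    · rw [if_neg hN]
      simp only [hsc]
      ring
  · intro a b l habl hcomp
    rw [← Finset.sum_add_distrib]
    have hle : ∑ c, (2 * sc a b l + (if comp c ∧ c = (a, b, l) then 1 else 0)) ≤ ∑ c, (uc c a + wc c b) :=
      Finset.sum_le_sum fun c _ => hslackc c a b l habl
    rw [Finset.sum_add_distrib, Finset.sum_const, card_univ, nsmul_eq_mul] at hle
    have hone : ∑ c : Fin m × Fin m × Fin K, (if comp c ∧ c = (a, b, l) then (1 : ℤ) else 0) = 1 := by
      rw [Finset.sum_eq_single (a, b, l)]
      · rw [if_pos ⟨hcomp, rfl⟩]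
      · intro c _ hc
        rw [if_neg (fun h => hc h.2)]
      · intro h; exact absurd (mem_univ _) h
    rw [hone] at hle
    have hN : N ≠ 0 := by
      intro hN
      have hK : Fintype.card (Fin m × Fin m × Fin K) = 0 := hN
      have hprod : m * (m * K) = 0 := by simpa [Fintype.card_prod, Fintype.card_fin] using hK
      rcases mul_eq_zero.mp hprod with hm | hmK
      · exact absurd a.isLt (by omega)
      · rcases mul_eq_zero.mp hmK with hm | hK0
        · exact absurd a.isLt (by omega)
        · exact absurd l.isLt (by omega)
    rw [if_neg hN, add_zero]
    simp only [hsc] at hle ⊢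
    have : (N : ℤ) = (Fintype.card (Fin m × Fin m × Fin K) : ℤ) := rfl
    linarith

/-- **DOMINANCE ⟺ A STRICT SCALED POTENTIAL CERTIFICATE** (LP duality for unique optima of the `K`-class assignment design, both directions,
integral).  The forward direction is `exists_scaledPotential_of_isDominant`; the backward direction is the tree's
`TropicalCensus.isDominant_of_scaledPotential`. [folklore] -/
theorem isDominant_iff_scaledPotential (d : Fin K → ℕ) (v ε : Fin m → Fin m → Fin K → ℤ) (θ : ℤ)
    (σ : Equiv.Perm (Fin m)) (μ : Fin m → Fin K) :
    IsDominant d v ε θ (σ, μ) ↔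
      ∃ S : ℤ, 0 < S ∧ ∃ u w : Fin m → ℤ,
        (∀ i, ε (σ i) i (μ i) ≠ 0) ∧
        (∀ i, u (σ i) + w i = S * (θ * (d (μ i) : ℤ) - v (σ i) i (μ i))) ∧
        (∀ a b l, ε a b l ≠ 0 → (σ b ≠ a ∨ μ b ≠ l) → S * (θ * (d l : ℤ) - v a b l) < u a + w b) := by
  constructor
  · exact exists_scaledPotential_of_isDominant d v ε θ σ μ
  · rintro ⟨S, hS, u, w, hpres, htight, hslack⟩
    exact isDominant_of_scaledPotential d v ε θ σ μ S hS u w hpres htight hslack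

end PotentialCertificate

end Summit.ValiantsHypothesis.ValiantsHypothesis.Theorems.KPlusLogSqLaw
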